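import Mathlib
import Summits.Parity.BatemanHorn.Theses.IsogenyRedei

/-!
# Proof of the first lemma of card `shape-kills-parity`:
`HistSmallVariation → QuadraticOmegaParity` (elementary Abel summation in the number of prime factors).
-/

namespace Summit.Parity.BatemanHorn.Cruxes.QuadraticOmegaParity.Ideator3Proof

open scoped BigOperators
open Filter Asymptotics Finset

/-- ω(f(n)) with the crux's junk conventions. -/
noncomputable def om (f : Polynomial ℤ) (n : ℕ) : ℕ :=
  ArithmeticFunction.cardDistinctFactors ((f.eval (n : ℤ)).toNat)

/-- The ω-histogram along `f` in the progression `a mod q`. -/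
noncomputable def hist (f : Polynomial ℤ) (q a x j : ℕ) : ℕ :=
  ((Finset.Icc 1 x).filter (fun n : ℕ => n ≡ a [MOD q] ∧ om f n = j)).card

def HistSmallVariation : Prop :=
  ∀ f : Polynomial ℤ, Irreducible f → f.natDegree = 2 → 0 < f.leadingCoeff → ∀ q a : ℕ, 0 < q →
    (fun x : ℕ => ∑' j : ℕ, |(hist f q a x (j + 1) : ℝ) - hist f q a x j|) =o[atTop]
      fun x : ℕ => (x : ℝ)

/-! ### An abstract Abel-summation inequality -/

/-- For a sequence `c : ℕ → ℝ` vanishing beyond `B`, the alternating sum over `range (B+1)` is bounded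
by the total variation `∑_{i ≤ B} |c i - c (i+1)|`. -/
lemma abs_alternating_le_variation (c : ℕ → ℝ) (B : ℕ) (hB : ∀ j, B < j → c j = 0) :
    |∑ j ∈ range (B + 1), (-1 : ℝ) ^ j * c j| ≤ ∑ i ∈ range (B + 1), |c i - c (i + 1)| := by
  -- telescoping: c j = ∑_{i ∈ Ico j (B+1)} (c i - c (i+1)) for j ≤ B+1
  have htel : ∀ j, j ≤ B + 1 → c j = ∑ i ∈ Ico j (B + 1), (c i - c (i + 1)) := by
    intro j hj
    rw [Finset.sum_Ico_eq_sum_range]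
    have : ∀ m, c j - c (j + m) = ∑ k ∈ range m, (c (j + k) - c (j + k + 1)) := by
      intro m
      induction m with
      | zero => simp
      | succ m ih => rw [Finset.sum_range_succ, ← ih]; ring_nf
    have h2 := this (B + 1 - j)
    have hzero : c (j + (B + 1 - j)) = 0 := hB _ (by omega)
    rw [hzero, sub_zero] at h2
    rw [h2]
  -- rewrite the alternating sum and swap the order of summation
  have hswap : ∑ j ∈ range (B + 1), (-1 : ℝ) ^ j * c j
      = ∑ i ∈ range (B + 1), (c i - c (i + 1)) * ∑ j ∈ range (i + 1), (-1 : ℝ) ^ j := by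
    calc ∑ j ∈ range (B + 1), (-1 : ℝ) ^ j * c j
        = ∑ j ∈ range (B + 1), ∑ i ∈ Ico j (B + 1), (-1 : ℝ) ^ j * (c i - c (i + 1)) := by
          refine Finset.sum_congr rfl fun j hj => ?_
          rw [htel j (by simpa using (Finset.mem_range.mp hj).le), Finset.mul_sum]
      _ = ∑ i ∈ range (B + 1), ∑ j ∈ range (i + 1), (-1 : ℝ) ^ j * (c i - c (i + 1)) := by
          rw [Finset.range_eq_Ico, Finset.sum_Ico_Ico_comm]
          refine Finset.sum_congr rfl fun i hi => ?_
          rw [Finset.range_eq_Ico]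
      _ = ∑ i ∈ range (B + 1), (c i - c (i + 1)) * ∑ j ∈ range (i + 1), (-1 : ℝ) ^ j := by
          refine Finset.sum_congr rfl fun i hi => ?_
          rw [Finset.mul_sum]
          refine Finset.sum_congr rfl fun j hj => ?_
          ring
  -- |∑_{j ≤ i} (-1)^j| ≤ 1
  have hgeom : ∀ i : ℕ, |∑ j ∈ range (i + 1), (-1 : ℝ) ^ j| ≤ 1 := by
    intro i
    induction i with
    | zero => simp
    | succ i ih =>
      rw [Finset.sum_range_succ]
      have : ∑ j ∈ range (i + 1), (-1 : ℝ) ^ j = if Even i then 1 else 0 := by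
        clear ih
        induction i with
        | zero => simp
        | succ k ihk =>
          rw [Finset.sum_range_succ, ihk]
          by_cases hk : Even k
          · have : ¬ Even (k + 1) := by simpa [Nat.even_add_one] using hk
            simp [hk, this]
          · have hk1 : Even (k + 1) := by simpa [Nat.even_add_one] using hk
            have hodd : Odd k := Nat.not_even_iff_odd.mp hk
            simp [hk, hk1]
      rw [this]
      by_cases hi : Even i
      · have : ¬ Even (i + 1) := by simpa [Nat.even_add_one] using hi
        have hodd : Odd (i + 1) := Nat.not_even_iff_odd.mp this
        simp [hi, Odd.neg_one_pow hodd]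
      · have hi1 : Even (i + 1) := by simpa [Nat.even_add_one] using hi
        simp [hi, Even.neg_one_pow hi1]
  rw [hswap]
  refine (Finset.abs_sum_le_sum_abs _ _).trans ?_
  refine Finset.sum_le_sum fun i hi => ?_
  rw [abs_mul]
  calc |c i - c (i + 1)| * |∑ j ∈ range (i + 1), (-1 : ℝ) ^ j|
      ≤ |c i - c (i + 1)| * 1 := by gcongr; exact hgeom i
    _ = |c i - c (i + 1)| := mul_one _


/-! ### The crux sum as an alternating sum over the histogram -/

/-- The AP-restricted index set. -/
noncomputable def F (q a x : ℕ) : Finset ℕ := (Finset.Icc 1 x).filter (fun n : ℕ => n ≡ a [MOD q])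

lemma hist_eq_card_filter (f : Polynomial ℤ) (q a x j : ℕ) :
    hist f q a x j = ((F q a x).filter (fun n => om f n = j)).card := by
  unfold hist F
  rw [Finset.filter_filter]

/-- A bound for `ω(f(n))` over `n ≤ x`. -/
noncomputable def B (f : Polynomial ℤ) (x : ℕ) : ℕ := (Finset.Icc 1 x).sup (om f)

lemma om_le_B (f : Polynomial ℤ) {x n : ℕ} (hn : n ∈ Finset.Icc 1 x) : om f n ≤ B f x :=
  Finset.le_sup (f := om f) hn

lemma hist_eq_zero_of_lt (f : Polynomial ℤ) (q a x : ℕ) {j : ℕ} (hj : B f x < j) :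
    hist f q a x j = 0 := by
  unfold hist
  rw [Finset.card_eq_zero, Finset.filter_eq_empty_iff]
  intro n hn h
  have := om_le_B f hn
  omega

/-- The signed sum along the progression equals the alternating sum of the histogram. -/
lemma sum_sgn_eq_alternating (f : Polynomial ℤ) (q a x : ℕ) :
    ∑ n ∈ F q a x, (-1 : ℝ) ^ om f n
      = ∑ j ∈ range (B f x + 1), (-1 : ℝ) ^ j * (hist f q a x j : ℝ) := by
  have hmaps : ∀ n ∈ F q a x, om f n ∈ range (B f x + 1) := by
    intro n hn
    have hn' : n ∈ Finset.Icc 1 x := (Finset.mem_filter.mp hn).1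
    exact Finset.mem_range.mpr (Nat.lt_succ_of_le (om_le_B f hn'))
  rw [← Finset.sum_fiberwise_of_maps_to hmaps]
  refine Finset.sum_congr rfl fun j hj => ?_
  rw [hist_eq_card_filter]
  have : ∀ n ∈ (F q a x).filter (fun n => om f n = j), (-1 : ℝ) ^ om f n = (-1 : ℝ) ^ j := by
    intro n hn
    rw [(Finset.mem_filter.mp hn).2]
  rw [Finset.sum_congr rfl this, Finset.sum_const, nsmul_eq_mul, mul_comm]

/-- Pointwise: the signed sum is bounded by the total variation of the histogram. -/
lemma abs_sum_sgn_le_tv (f : Polynomial ℤ) (q a x : ℕ) :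
    |∑ n ∈ F q a x, (-1 : ℝ) ^ om f n|
      ≤ ∑' j : ℕ, |(hist f q a x (j + 1) : ℝ) - hist f q a x j| := by
  rw [sum_sgn_eq_alternating]
  have hvan : ∀ j, B f x < j → (hist f q a x j : ℝ) = 0 := by
    intro j hj; simp [hist_eq_zero_of_lt f q a x hj]
  refine (abs_alternating_le_variation (fun j => (hist f q a x j : ℝ)) (B f x) hvan).trans ?_
  -- partial sum ≤ tsum (nonnegative terms, finitely supported)
  have hsupp : ∀ j ∉ range (B f x + 1), |(hist f q a x (j + 1) : ℝ) - hist f q a x j| = 0 := by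
    intro j hj
    have hj' : B f x < j := by simpa [Finset.mem_range] using hj
    rw [hvan j hj', hvan (j + 1) (by omega)]; simp
  have hsum : Summable (fun j : ℕ => |(hist f q a x (j + 1) : ℝ) - hist f q a x j|) :=
    summable_of_ne_finset_zero hsupp
  rw [tsum_eq_sum hsupp]
  refine Finset.sum_le_sum fun i hi => ?_
  rw [abs_sub_comm]

/-- **First lemma of card `shape-kills-parity`, proved**: small total variation of the ω-histogram
along every irreducible quadratic in every progression implies `QuadraticOmegaParity`. -/
theorem shapeToParity :
    HistSmallVariation → Summit.Parity.BatemanHorn.Theses.IsogenyRedei.QuadraticOmegaParity := by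
  intro hTV f hf hdeg hlc q a hq
  have h := hTV f hf hdeg hlc q a hq
  have hO : (fun x : ℕ => ∑ n ∈ (Finset.Icc 1 x).filter (fun n : ℕ => n ≡ a [MOD q]),
      (-1 : ℝ) ^ ArithmeticFunction.cardDistinctFactors ((f.eval (n : ℤ)).toNat))
      =O[atTop] (fun x : ℕ => ∑' j : ℕ, |(hist f q a x (j + 1) : ℝ) - hist f q a x j|) := by
    refine Asymptotics.IsBigO.of_bound 1 (Filter.Eventually.of_forall fun x => ?_)
    have hT : 0 ≤ ∑' j : ℕ, |(hist f q a x (j + 1) : ℝ) - hist f q a x j| :=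
      tsum_nonneg fun j => abs_nonneg _
    rw [one_mul, Real.norm_eq_abs, Real.norm_eq_abs, abs_of_nonneg hT]
    exact abs_sum_sgn_le_tv f q a x
  exact hO.trans_isLittleO h


/-! ### Unimodality + Erdős–Kac (no atom) ⇒ small variation -/

def EKNoAtom : Prop :=
  ∀ f : Polynomial ℤ, Irreducible f → f.natDegree = 2 → 0 < f.leadingCoeff → ∀ q a : ℕ, 0 < q →
    ∀ ε : ℝ, 0 < ε → ∀ᶠ x : ℕ in atTop, ∀ j : ℕ, (hist f q a x j : ℝ) ≤ ε * x

def HistUnimodal : Prop :=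
  ∀ f : Polynomial ℤ, Irreducible f → f.natDegree = 2 → 0 < f.leadingCoeff → ∀ q a : ℕ, 0 < q →
    ∀ᶠ x : ℕ in atTop, ∃ m : ℕ, (∀ j : ℕ, j < m → hist f q a x j ≤ hist f q a x (j + 1)) ∧
      (∀ j : ℕ, m ≤ j → hist f q a x (j + 1) ≤ hist f q a x j)

/-- Total variation of a unimodal finitely supported sequence of naturals is at most twice its
value at the mode. -/
lemma variation_le_two_mul_of_unimodal (c : ℕ → ℕ) (m N : ℕ) (hN : ∀ j, N ≤ j → c j = 0)
    (hinc : ∀ j, j < m → c j ≤ c (j + 1)) (hdec : ∀ j, m ≤ j → c (j + 1) ≤ c j) :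
    ∑ j ∈ range N, |(c (j + 1) : ℝ) - c j| ≤ 2 * c m := by
  -- split the range at min m N
  have key : ∀ K, ∑ j ∈ range K, |(c (j + 1) : ℝ) - c j|
      = (∑ j ∈ (range K).filter (fun j => j < m), ((c (j + 1) : ℝ) - c j))
        + ∑ j ∈ (range K).filter (fun j => ¬ j < m), ((c j : ℝ) - c (j + 1)) := by
    intro K
    rw [← Finset.sum_filter_add_sum_filter_not (range K) (fun j => j < m)]
    congr 1
    · refine Finset.sum_congr rfl fun j hj => ?_
      have hjm : j < m := (Finset.mem_filter.mp hj).2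
      rw [abs_of_nonneg]
      have := hinc j hjm
      exact sub_nonneg.mpr (by exact_mod_cast this)
    · refine Finset.sum_congr rfl fun j hj => ?_
      have hjm : m ≤ j := not_lt.mp (Finset.mem_filter.mp hj).2
      rw [abs_sub_comm, abs_of_nonneg]
      have := hdec j hjm
      exact sub_nonneg.mpr (by exact_mod_cast this)
  rw [key N]
  -- first block: telescopes over range (min m N) to c (min m N) - c 0 ≤ c m
  have hfilt1 : (range N).filter (fun j => j < m) = range (min m N) := by
    ext j; simp [Finset.mem_filter, Finset.mem_range]; omega
  have hfilt2 : (range N).filter (fun j => ¬ j < m) = Ico (min m N) N := by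
    ext j; simp [Finset.mem_filter, Finset.mem_range, Finset.mem_Ico]; omega
  rw [hfilt1, hfilt2]
  have tel1 : ∑ j ∈ range (min m N), ((c (j + 1) : ℝ) - c j) = c (min m N) - c 0 := by
    exact Finset.sum_range_sub (fun j => (c j : ℝ)) (min m N)
  have tel2 : ∑ j ∈ Ico (min m N) N, ((c j : ℝ) - c (j + 1)) = c (min m N) - c N := by
    have h := Finset.sum_Ico_sub (f := fun j => (c j : ℝ)) (min_le_right m N)
    -- sum_Ico_sub gives Σ (c (j+1) - c j) = c N - c (min m N)
    have : ∑ j ∈ Ico (min m N) N, ((c j : ℝ) - c (j + 1))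
        = -∑ j ∈ Ico (min m N) N, ((c (j + 1) : ℝ) - c j) := by
      rw [← Finset.sum_neg_distrib]; refine Finset.sum_congr rfl fun j _ => by ring
    rw [this, h]; ring
  rw [tel1, tel2, hN N le_rfl]
  -- c (min m N) ≤ c m
  have hmin : (c (min m N) : ℝ) ≤ c m := by
    by_cases h : m ≤ N
    · rw [min_eq_left h]
    · have hNm : N ≤ m := (not_le.mp h).le
      rw [min_eq_right hNm, hN N le_rfl]
      exact_mod_cast Nat.zero_le _
  have h0 : (0 : ℝ) ≤ c 0 := by exact_mod_cast Nat.zero_le _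
  push_cast
  linarith

/-- **Second lemma of card `shape-kills-parity`, proved**: no atom (Erdős–Kac) and unimodality of the
ω-histogram give small total variation. -/
theorem unimodalToVariation : EKNoAtom → HistUnimodal → HistSmallVariation := by
  intro hEK hU f hf hdeg hlc q a hq
  rw [Asymptotics.isLittleO_iff]
  intro ε hε
  have h1 := hEK f hf hdeg hlc q a hq (ε / 2) (by positivity)
  have h2 := hU f hf hdeg hlc q a hq
  filter_upwards [h1, h2] with x hx hux
  obtain ⟨m, hinc, hdec⟩ := hux
  -- finitely supported: hist … j = 0 for j > B f x
  have hsupp : ∀ j, B f x + 1 ≤ j → hist f q a x j = 0 := fun j hj =>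
    hist_eq_zero_of_lt f q a x (by omega)
  have hzero : ∀ j ∉ range (B f x + 1), |(hist f q a x (j + 1) : ℝ) - hist f q a x j| = 0 := by
    intro j hj
    have hj' : B f x + 1 ≤ j := by simpa [Finset.mem_range] using hj
    rw [hsupp j hj', hsupp (j + 1) (by omega)]; simp
  rw [Real.norm_eq_abs, Real.norm_eq_abs, abs_of_nonneg (tsum_nonneg fun j => abs_nonneg _),
    tsum_eq_sum hzero]
  have hvar := variation_le_two_mul_of_unimodal (fun j => hist f q a x j) m (B f x + 1) hsupp hinc hdec
  have hm : (hist f q a x m : ℝ) ≤ ε / 2 * x := hx m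
  have hxabs : (x : ℝ) ≤ |(x : ℝ)| := le_abs_self _
  calc ∑ j ∈ range (B f x + 1), |(hist f q a x (j + 1) : ℝ) - hist f q a x j|
      ≤ 2 * hist f q a x m := hvar
    _ ≤ 2 * (ε / 2 * x) := by gcongr
    _ = ε * x := by ring
    _ ≤ ε * |(x : ℝ)| := by gcongr

end Summit.Parity.BatemanHorn.Cruxes.QuadraticOmegaParity.Ideator3Proof
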